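import Summits.QuantumFields.YangMills.Theorems.BalabanUVNodesN22W1YoungLipschitzOfCouplingHoloVertex
import Summits.QuantumFields.YangMills.Theorems.BalabanUVNodesN22WindowSoftTwoPointAtSlots

/-!
# BalabanUVNodes ∕ node N22 = NE9 — THE (β′) LETTER `WindowedNE9 F (localizedSum F S emb) …` WITH ITS ACTIVITY-LEVEL SLOTS READ FROM
# COUPLING HOLOMORPHY AND FROM PRINT: dag-n22-w2's capstone `windowedNE9_localizedSum_of_activitySlots` (p605956) with (i) BOTH W1 slots
# `Bound238` ∕ `YoungLipschitz` DISCHARGED from J31's margin datum («(2.38) on the young-coupling margin») — plain and VERTEX editions —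
# and (ii) the activity holomorphy through the reading DISCHARGED from W1's PRINTED slot `AnalyticH` ([II] p. 15) and a holomorphic reading

Cell `pub-ymgap`, HUMAN RULING D-0062 (Track A), R134 seat `pub-ymgap-dag-n22-c` (N22 NE9 s1), generation 12, module J32′ (the «J31-downstream» re-scope of
my withdrawn INTENT-J32: the composition (t8) itself is dag-n22-w2 g3's file (A), FIRST claim, consumed here BY NAME).  THEOREMS ONLY (0 `def`, 0 `sorry`);
imports J31b `…N22W1YoungLipschitzOfCouplingHoloVertex` (→ J31 p605695) and dag-n22-w2 g3's (A) `…N22WindowSoftTwoPointAtSlots` (p605956).  Filed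
`--supports stmt-QuantumFields-20544` (K3⁷) as a HELPER; count-neutral.

WHAT (0 `def`, 0 `sorry`).
* §1 `differentiableOn_H_comp_of_analyticH` (+ `analyticH_of_analyticT`: W1's termwise `AnalyticT` ⟹ `AnalyticH`, finite sum) — CHAIN RULE AT THE ACTIVITIES: W1's PRINTED slot `ClusterStep.AnalyticH S Wk sp` ([II] p. 15 «the activities in
  (2.13) … are analytic functions of (𝐔,𝐉), on the space U^c_{k+1}(X, α₀, α₁)») + a reading `Φ : Ec → Φ-pairs` holomorphic on `U` and mapping `U` into the
  space of every polymer inside `X` ⟹ (A)'s hypothesis `hHhol`: every `z ↦ H(Z; hist; Φ z)`, `Z ⊆ X`, holomorphic on `U`.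
* §2 ★★★ `windowedNE9_localizedSum_of_coordHoloSlots` — (A) for a window `W ⊆ Window γ` (prefix sets `W1.box γ k`) with `h238` ∕ `hYL` DISCHARGED from J31's
  margin datum per `(K, k)` (radii `ρt (k+1) i > 0`, bound `A·e^{−R d_{k+1}(Z)}`; Cauchy table `Λ (k+1) i = 4A∕ρt (k+1) i`).
* §2b ★★★ `windowedNE9_localizedSum_of_coordHoloVertexSlots` — the VERTEX edition: OLDER coordinates on uniform margins (amplitude `A`), the LAST one on
  RELATIVE discs `D̄(s, c·s)` with the bound `A′·s·e^{−R d}` vanishing linearly at the vertex (J31b); table `Λ n i = if i + 1 < n then 4A∕ρt n i else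
  8A′∕min(c,1)`, the `Bound238` amplitude is `A′γ` (J31b `bound238_box_of_coordHoloLast`).
* §3 ★★★ `windowedNE9_localizedSum_of_printedSlots` — (A) with `hHhol` DISCHARGED by §1 from `AnalyticH` at every `(K, k)` and `DifferentiableOn ℂ (Φ K k X)
  (U K k X)` (configuration algebra `𝔸` a normed ℂ-algebra, as of record — `Node00/Sect2FrameOfRecord`: `𝔸 := ℂ^N →L[ℂ] ℂ^N`; its ℝ-structure is Mathlib's
  `NormedAlgebra.complexToReal`).  The (β′) letter's displayed inputs then read: W1's THREE slots `Bound238` ∕ `YoungLipschitz` ∕ `AnalyticH` on the space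
  tables (node N10's Lemmas 1–3 ∕ NODE A at the towers of a localizing reading), the holomorphic readings `Φ` with chart ∕ space clauses, the soft site weights
  with the minimizer tails, numerals — or, via §2∕§2b, the margin data instead of the first two slots.

HONEST FRAMING.  Count-neutral by-name composition; every displayed input is a HYPOTHESIS asserted nowhere; nothing of Bałaban's constructed; N22 NOT
discharged (typed 28∕28 · discharged 5∕27 UNCHANGED); K3⁷ OPEN, not claimed; NE9 NOT IN PRINT for d = 4; one finite four-torus programme at fixed ε — NOT
infinite volume, NOT OS on ℝ⁴, NOT a mass gap, NOT Clay.  0 `sorry`, 0 `def`, standard axioms.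

References (TYPES only): [I] = [Balaban1987RG1] T. Bałaban, Commun. Math. Phys. **109** (1987) 249–301 — (1.7) p. 261, §1 p. 263, (1.20)–(1.21) p. 264,
(4.35)–(4.37) pp. 290–291, (5.10) p. 293; [II] = [Balaban1988RG2Cluster] T. Bałaban, Commun. Math. Phys. **116** (1988) 1–22 — (2.5)–(2.10) pp. 12–14,
(2.13)–(2.14) pp. 14–15 (analyticity statement), Lemma 3 (2.38) p. 20, (2.39)–(2.41) p. 21.
-/

noncomputable section

open Filter Topology Set Metric
open scoped BigOperators

namespace YMDAG.N22.WindowedOfCouplingHolo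

open Literature.MathematicalPhysics.QuantumFieldTheory.Balaban1983to89
open Literature.MathematicalPhysics.QuantumFieldTheory.Balaban1983to89.T4Continuum (T4Family)
open Literature.MathematicalPhysics.QuantumFieldTheory.Balaban1983to89.T4OutputRate (Window)
open Literature.MathematicalPhysics.QuantumFieldTheory.Balaban1983to89.Node00 (siteOfInt)
open Literature.MathematicalPhysics.QuantumFieldTheory.Balaban1983to89.Node00.Sect2 (domCount domSys CPair)
open Literature.MathematicalPhysics.QuantumFieldTheory.Balaban1983to89.Node00.LocalizedSum17 (localizedSum ReadingMaps)
open Literature.MathematicalPhysics.QuantumFieldTheory.Balaban1983to89.Node00.W1 (ClusterTower ClusterStep box)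
open Literature.MathematicalPhysics.QuantumFieldTheory.Balaban1983to89.Node00.U3OfKernels (histPrefix)
open Literature.MathematicalPhysics.QuantumFieldTheory.Balaban1983to89.Node00.U3KernelLetters (WindowedNE9)
open Literature.MathematicalPhysics.QuantumFieldTheory.Balaban1983to89.B12Decay510 (delta1)
open Literature.MathematicalPhysics.QuantumFieldTheory.Balaban1983to89.B12Decay510Window (K₁)
open Literature.MathematicalPhysics.QuantumFieldTheory.Balaban1983to89.B12Decay510Torus (distCT nearT)
open Literature.MathematicalPhysics.QuantumFieldTheory.Balaban1983to89.B12TreeDecay (K₀ kappa₀)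
open Literature.MathematicalPhysics.QuantumFieldTheory.Balaban1983to89.TreeLengthTorus (TPt)
open YMDAG.N22.WindowSoftTwoPoint (windowedNE9_localizedSum_of_activitySlots)
open YMDAG.N22.W1 (bound238_box_of_coordHolo youngLipschitz_box_of_coordHolo bound238_box_of_coordHoloLast youngLipschitz_box_of_coordHolo_vertex)

/-! ## §1 The activity holomorphy through the reading FROM W1's PRINTED slot `AnalyticH` ([II] p. 15) and a holomorphic reading -/

section Printed

variable {P : Params} {𝔸 : Type*} [NormedRing 𝔸] [NormedAlgebra ℂ 𝔸] {M k : ℕ}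

/-- **CHAIN RULE AT THE ACTIVITIES.**  W1's PRINTED slot `AnalyticH S Wk sp` ([II] p. 15) and a reading `Φ : Ec → Φ-pairs` holomorphic on `U`, mapping `U`
into the space of every polymer inside `X`, give: every `z ↦ H(Z; hist; Φ z)`, `Z ⊆ X`, is holomorphic on `U` (`hist` a prefix of `Wk`).
[cite: Balaban1988RG2Cluster, p.15 (analyticity statement)] -/
theorem differentiableOn_H_comp_of_analyticH (S : ClusterStep P 𝔸 M k) (Wk : Set (Fin (k + 1) → ℝ))
    (sp : (domSys P M (k + 1)).Dom → Set (CPair P 𝔸)) (hAn : S.AnalyticH Wk sp) {hist : Fin (k + 1) → ℝ} (hh : hist ∈ Wk)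
    {Ec : Type*} [NormedAddCommGroup Ec] [NormedSpace ℂ Ec] (Φ : Ec → CPair P 𝔸) {U : Set Ec} (hΦ : DifferentiableOn ℂ Φ U)
    (X : (domSys P M (k + 1)).Dom) (hΦsp : ∀ z ∈ U, ∀ Z : (domSys P M (k + 1)).Dom, Z.1 ⊆ X.1 → Φ z ∈ sp Z) :
    ∀ Z : (domSys P M (k + 1)).Dom, Z.1 ⊆ X.1 → DifferentiableOn ℂ (fun z => S.H hist (Φ z) Z) U :=
  fun Z hZ => (hAn hist hh Z).differentiableOn.comp hΦ fun z hz => hΦsp z hz Z hZ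

/-- **TERMWISE ⟹ ACTIVITY-WISE (analyticity in the configuration).**  W1's termwise slot `AnalyticT S Wk sp` ([II] (2.14) p. 15 «We consider it as an
analytic function of (𝐔,𝐉) in the space U^c_{k+1}(X, α₀, α₁)», per term) gives the activity slot `AnalyticH S Wk sp` — the activity (2.11) is the finite sum of
its terms (`Finset.analyticOnNhd_fun_sum`). [cite: Balaban1988RG2Cluster, (2.11) p.14 and (2.14) p.15] -/
theorem analyticH_of_analyticT (S : ClusterStep P 𝔸 M k) (Wk : Set (Fin (k + 1) → ℝ)) (sp : (domSys P M (k + 1)).Dom → Set (CPair P 𝔸))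
    (hT : S.AnalyticT Wk sp) : S.AnalyticH Wk sp := fun g hg Z => by
  show AnalyticOnNhd ℂ (fun φ => ∑ i ∈ S.idx Z, S.T i g φ) (sp Z)
  exact Finset.analyticOnNhd_fun_sum (S.idx Z) fun i hi => hT g hg Z i hi

end Printed

/-! ## §2 ★★★ The (β′) letter with BOTH W1 slots fed by J31's margin datum on the boxes -/

section MarginDatum

variable (F : T4Family) {𝔸 : Type*} [NormedRing 𝔸] [NormedAlgebra ℝ 𝔸] {V : Type*} [NormedAddCommGroup V] [NormedSpace ℝ V]
  {ι' : Type*} [Fintype ι'] {M : ℕ}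

/-- A window history's prefix lies in the box. [cite: Balaban1987RG1, Thm 1 p.259 (bookkeeping)] -/
theorem histPrefix_mem_box {γ : ℝ} {g : ℕ → ℝ} (hg : g ∈ Window γ) (k : ℕ) : histPrefix g k ∈ box γ k := fun i => hg i

open Classical in
/-- ★★★ **THE (β′) LETTER FROM «(2.38) ON THE YOUNG-COUPLING MARGIN».**  dag-n22-w2's `windowedNE9_localizedSum_of_activitySlots` for a window `W ⊆ Window γ`
(prefix sets `W1.box γ k`) with BOTH W1 slots DISCHARGED from J31's margin datum: per `(K, k)`, prefix `hist ∈ box γ k`, polymer `Z`, configuration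
`φ ∈ sp K k Z` and coordinate `i`, a holomorphic extension of `t ↦ H(Z; hist|hist_i := t; φ)` to a set containing the closed `ρt (k+1) i`-discs about `]0, γ]`,
bounded by `A·e^{−R d_{k+1}(Z)}` (`bound238_box_of_coordHolo`, `youngLipschitz_box_of_coordHolo`); Cauchy table `Λ (k+1) i = 4A∕ρt (k+1) i`.  Vertex-awareness as
in J31 (use §2b when the last coupling's datum is the relative one). [cite: Balaban1987RG1, §1 p.263, (1.20)-(1.21) p.264 and (5.10) p.293; Balaban1988RG2Cluster, (2.13) p.14, (2.38) p.20 and (2.39)-(2.41) p.21] -/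
theorem windowedNE9_localizedSum_of_coordHoloSlots (m' : ℕ) (M : ℕ) [NeZero M] (hM : M = F.L ^ m')
    (S : (K : ℕ) → ClusterTower (F.P K) 𝔸 M) (emb : ReadingMaps F 𝔸 𝔸) (ρ : V →L[ℝ] 𝔸) (bV : Module.Basis ι' ℝ V)
    {γ : ℝ} (W : Set (ℕ → ℝ)) (hWγ : W ⊆ Window γ)
    (sp : (K k : ℕ) → (domSys (F.P K) M (k + 1)).Dom → Set (CPair (F.P K) 𝔸))
    {A R r₁ κ δ₀ B₃ r : ℝ} (ρt : ℕ → ℕ → ℝ) (hρt : ∀ n i, 0 < ρt n i)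
    (hA : 0 < A) (hr₁ : 0 ≤ r₁) (hκ : κ ≤ r₁) (hκ₀ : kappa₀ (4 * 2 ^ 4) (2 * 4) ≤ κ / 2) (hrate : r₁ + 2 * (64 * Real.log 162) + 2 ≤ R)
    (hsmall : 2 * A * Real.exp (5 * r₁ + 1) * K₀ 64 8 * 9 * 64 ≤ 1) (hδ₀ : 0 < δ₀) (hB₃ : 0 ≤ B₃) (hr : 0 < r)
    (hH : ∀ (K k : ℕ), ∀ hist ∈ box γ k, ∀ (Z : (domSys (F.P K) M (k + 1)).Dom), ∀ φ ∈ sp K k Z, ∀ i : Fin (k + 1),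
      ∃ (Hc : ℂ → ℂ) (O : Set ℂ), DifferentiableOn ℂ Hc O ∧ (∀ t ∈ Ioc (0 : ℝ) γ, closedBall (t : ℂ) (ρt (k + 1) i) ⊆ O) ∧
        (∀ z ∈ O, ‖Hc z‖ ≤ A * Real.exp (-(R * (domSys (F.P K) M (k + 1)).dj Z))) ∧
        (∀ t ∈ Ioc (0 : ℝ) γ, Hc t = ((S K) k).H (Function.update hist i t) φ Z))
    (Ec : ℕ → ℕ → Type*) [∀ K k, NormedAddCommGroup (Ec K k)] [∀ K k, NormedSpace ℂ (Ec K k)]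
    (ι : (K k : ℕ) → (domSys (F.P K) M (k + 1)).Dom → ((Fin (F.P K).d → Site (F.P K) (k + 1) → V) →L[ℝ] Ec K k))
    (Φ : (K k : ℕ) → (domSys (F.P K) M (k + 1)).Dom → Ec K k → CPair (F.P K) 𝔸)
    (U : (K k : ℕ) → (domSys (F.P K) M (k + 1)).Dom → Set (Ec K k)) (hU : ∀ K k X, IsOpen (U K k X)) (hrU : ∀ K k X, ball (0 : Ec K k) r ⊆ U K k X)
    (hHhol : ∀ g ∈ W, ∀ (K k : ℕ) (X Z : (domSys (F.P K) M (k + 1)).Dom), Z.1 ⊆ X.1 →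
      DifferentiableOn ℂ (fun z => ((S K) k).H (histPrefix g k) (Φ K k X z) Z) (U K k X))
    (hΦemb : ∀ (K k : ℕ) (X : (domSys (F.P K) M (k + 1)).Dom) (B : Fin (F.P K).d → Site (F.P K) (k + 1) → V),
      Φ K k X (ι K k X B) = emb K k (fun l t => NormedSpace.exp (ρ (B l t))))
    (hΦsp : ∀ (K k : ℕ) (X : (domSys (F.P K) M (k + 1)).Dom), ∀ z ∈ U K k X, ∀ Z : (domSys (F.P K) M (k + 1)).Dom, Z.1 ⊆ X.1 → Φ K k X z ∈ sp K k Z)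
    (w : (K k : ℕ) → (domSys (F.P K) M (k + 1)).Dom → Site (F.P K) (k + 1) → ℝ) (hw₀ : ∀ K k X t, 0 ≤ w K k X t)
    (hw : ∀ (K k : ℕ) (X : (domSys (F.P K) M (k + 1)).Dom) (l : Fin (F.P K).d) (t : Site (F.P K) (k + 1)) (c : ι'),
      ‖ι K k X (Pi.single l (Pi.single t (bV c)))‖ ≤ w K k X t)
    (htail : ∀ (K k : ℕ) (X : (domSys (F.P K) M (k + 1)).Dom) (t : Site (F.P K) (k + 1)),
      let e : Site (F.P K) (k + 1) → TPt 4 (domCount (F.P K) M (k + 1) * M) := fun x i => (ZMod.cast (x i) : ZMod (domCount (F.P K) M (k + 1) * M))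
      w K k X t ≤ B₃ * Real.exp (-δ₀ * distCT (domCount (F.P K) M (k + 1)) M (e t) (nearT (M := M) (e t) X))) :
    WindowedNE9 F (localizedSum F S emb) ρ bV W (delta1 δ₀ κ ((M : ℝ) * 4))
      (fun k i => (16 * (8 * (Real.exp 1 * 9 * 64 * K₀ 64 8 ^ 2)) * B₃ ^ 2 / r ^ 2) *
        Real.exp (delta1 δ₀ κ ((M : ℝ) * 4) * ((M : ℝ) * 4) * 3) * K₀ (4 * 2 ^ 4) (2 * 4) * K₁ 4 (δ₀ / 2) * (4 * A / ρt k i)) :=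
  windowedNE9_localizedSum_of_activitySlots F m' M hM S emb ρ bV W (fun _ k => box γ k) (fun g hg _ k => histPrefix_mem_box (hWγ hg) k) sp
    (fun n i => 4 * A / ρt n i) hA hr₁ hκ hκ₀ hrate hsmall (fun n i => div_nonneg (mul_nonneg (by norm_num) hA.le) (hρt n i).le) hδ₀ hB₃ hr
    (fun K k => bound238_box_of_coordHolo ((S K) k) (sp K k) (fun i : Fin (k + 1) => ρt (k + 1) i) (fun i => hρt _ _) (hH K k))
    (fun K k => youngLipschitz_box_of_coordHolo ((S K) k) (sp K k) (fun i : Fin (k + 1) => ρt (k + 1) i) (fun i => hρt _ _) (hH K k))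
    Ec ι Φ U hU hrU hHhol hΦemb hΦsp w hw₀ hw htail

open Classical in
/-- ★★★ **THE (β′) LETTER, VERTEX EDITION** — print's dilation shape in the LAST coupling: per `(K, k)`, the OLDER coordinates `i < k` carry the uniform-margin
datum (radii `ρt (k+1) i`, bound `A·e^{−R d}`), the LAST coordinate the relative datum (discs `D̄(s, c·s)`, bound `A′·s·e^{−R d}`, J31b); then (A) fires with
`Bound238` at amplitude `A′γ` (`bound238_box_of_coordHoloLast`; Road 1's numerals are read at `A′γ`) and the g-INDEPENDENT table
`Λ n i = if i + 1 < n then 4A∕ρt n i else 8A′∕min(c,1)` (`youngLipschitz_box_of_coordHolo_vertex`). [cite: Balaban1987RG1, §1 p.263, (1.20)-(1.21) p.264 and (5.10) p.293; Balaban1988RG2Cluster, (2.5)-(2.10) pp.12-14, (2.38) p.20 and (2.39)-(2.41) p.21] -/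
theorem windowedNE9_localizedSum_of_coordHoloVertexSlots (m' : ℕ) (M : ℕ) [NeZero M] (hM : M = F.L ^ m')
    (S : (K : ℕ) → ClusterTower (F.P K) 𝔸 M) (emb : ReadingMaps F 𝔸 𝔸) (ρ : V →L[ℝ] 𝔸) (bV : Module.Basis ι' ℝ V)
    {γ : ℝ} (W : Set (ℕ → ℝ)) (hWγ : W ⊆ Window γ)
    (sp : (K k : ℕ) → (domSys (F.P K) M (k + 1)).Dom → Set (CPair (F.P K) 𝔸))
    {A A' R r₁ κ δ₀ B₃ r c : ℝ} (ρt : ℕ → ℕ → ℝ) (hρt : ∀ n i, 0 < ρt n i) (hA : 0 ≤ A) (hA' : 0 ≤ A') (hc : 0 < c)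
    (hAγ : 0 < A' * γ) (hr₁ : 0 ≤ r₁) (hκ : κ ≤ r₁) (hκ₀ : kappa₀ (4 * 2 ^ 4) (2 * 4) ≤ κ / 2) (hrate : r₁ + 2 * (64 * Real.log 162) + 2 ≤ R)
    (hsmall : 2 * (A' * γ) * Real.exp (5 * r₁ + 1) * K₀ 64 8 * 9 * 64 ≤ 1) (hδ₀ : 0 < δ₀) (hB₃ : 0 ≤ B₃) (hr : 0 < r)
    (hOld : ∀ (K k : ℕ), ∀ hist ∈ box γ k, ∀ (Z : (domSys (F.P K) M (k + 1)).Dom), ∀ φ ∈ sp K k Z, ∀ i : Fin (k + 1), (i : ℕ) < k →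
      ∃ (Hc : ℂ → ℂ) (O : Set ℂ), DifferentiableOn ℂ Hc O ∧ (∀ t ∈ Ioc (0 : ℝ) γ, closedBall (t : ℂ) (ρt (k + 1) i) ⊆ O) ∧
        (∀ z ∈ O, ‖Hc z‖ ≤ A * Real.exp (-(R * (domSys (F.P K) M (k + 1)).dj Z))) ∧
        (∀ t ∈ Ioc (0 : ℝ) γ, Hc t = ((S K) k).H (Function.update hist i t) φ Z))
    (hLast : ∀ (K k : ℕ), ∀ hist ∈ box γ k, ∀ (Z : (domSys (F.P K) M (k + 1)).Dom), ∀ φ ∈ sp K k Z,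
      ∃ (Hc : ℂ → ℂ) (O : Set ℂ), DifferentiableOn ℂ Hc O ∧ (∀ s ∈ Ioc (0 : ℝ) γ, closedBall (s : ℂ) (c * s) ⊆ O) ∧
        (∀ s ∈ Ioc (0 : ℝ) γ, ∀ z ∈ closedBall (s : ℂ) (c * s), ‖Hc z‖ ≤ A' * s * Real.exp (-(R * (domSys (F.P K) M (k + 1)).dj Z))) ∧
        (∀ t ∈ Ioc (0 : ℝ) γ, Hc t = ((S K) k).H (Function.update hist (Fin.last k) t) φ Z))
    (Ec : ℕ → ℕ → Type*) [∀ K k, NormedAddCommGroup (Ec K k)] [∀ K k, NormedSpace ℂ (Ec K k)]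
    (ι : (K k : ℕ) → (domSys (F.P K) M (k + 1)).Dom → ((Fin (F.P K).d → Site (F.P K) (k + 1) → V) →L[ℝ] Ec K k))
    (Φ : (K k : ℕ) → (domSys (F.P K) M (k + 1)).Dom → Ec K k → CPair (F.P K) 𝔸)
    (U : (K k : ℕ) → (domSys (F.P K) M (k + 1)).Dom → Set (Ec K k)) (hU : ∀ K k X, IsOpen (U K k X)) (hrU : ∀ K k X, ball (0 : Ec K k) r ⊆ U K k X)
    (hHhol : ∀ g ∈ W, ∀ (K k : ℕ) (X Z : (domSys (F.P K) M (k + 1)).Dom), Z.1 ⊆ X.1 →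
      DifferentiableOn ℂ (fun z => ((S K) k).H (histPrefix g k) (Φ K k X z) Z) (U K k X))
    (hΦemb : ∀ (K k : ℕ) (X : (domSys (F.P K) M (k + 1)).Dom) (B : Fin (F.P K).d → Site (F.P K) (k + 1) → V),
      Φ K k X (ι K k X B) = emb K k (fun l t => NormedSpace.exp (ρ (B l t))))
    (hΦsp : ∀ (K k : ℕ) (X : (domSys (F.P K) M (k + 1)).Dom), ∀ z ∈ U K k X, ∀ Z : (domSys (F.P K) M (k + 1)).Dom, Z.1 ⊆ X.1 → Φ K k X z ∈ sp K k Z)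
    (w : (K k : ℕ) → (domSys (F.P K) M (k + 1)).Dom → Site (F.P K) (k + 1) → ℝ) (hw₀ : ∀ K k X t, 0 ≤ w K k X t)
    (hw : ∀ (K k : ℕ) (X : (domSys (F.P K) M (k + 1)).Dom) (l : Fin (F.P K).d) (t : Site (F.P K) (k + 1)) (c : ι'),
      ‖ι K k X (Pi.single l (Pi.single t (bV c)))‖ ≤ w K k X t)
    (htail : ∀ (K k : ℕ) (X : (domSys (F.P K) M (k + 1)).Dom) (t : Site (F.P K) (k + 1)),
      let e : Site (F.P K) (k + 1) → TPt 4 (domCount (F.P K) M (k + 1) * M) := fun x i => (ZMod.cast (x i) : ZMod (domCount (F.P K) M (k + 1) * M))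
      w K k X t ≤ B₃ * Real.exp (-δ₀ * distCT (domCount (F.P K) M (k + 1)) M (e t) (nearT (M := M) (e t) X))) :
    WindowedNE9 F (localizedSum F S emb) ρ bV W (delta1 δ₀ κ ((M : ℝ) * 4))
      (fun k i => (16 * (8 * (Real.exp 1 * 9 * 64 * K₀ 64 8 ^ 2)) * B₃ ^ 2 / r ^ 2) *
        Real.exp (delta1 δ₀ κ ((M : ℝ) * 4) * ((M : ℝ) * 4) * 3) * K₀ (4 * 2 ^ 4) (2 * 4) * K₁ 4 (δ₀ / 2) *
          (if i + 1 < k then 4 * A / ρt k i else 8 * A' / min c 1)) := by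
  have hΛ0 : ∀ n i : ℕ, 0 ≤ (if i + 1 < n then 4 * A / ρt n i else 8 * A' / min c 1) := by
    intro n i
    split_ifs
    · exact div_nonneg (mul_nonneg (by norm_num) hA) (hρt n i).le
    · exact div_nonneg (mul_nonneg (by norm_num) hA') (le_min hc.le zero_le_one)
  have hYL : ∀ K k, ((S K) k).YoungLipschitz (box γ k) (sp K k)
      (fun i : Fin (k + 1) => if (i : ℕ) + 1 < k + 1 then 4 * A / ρt (k + 1) i else 8 * A' / min c 1) R := by
    intro K k
    have e : (fun i : Fin (k + 1) => if (i : ℕ) + 1 < k + 1 then 4 * A / ρt (k + 1) i else 8 * A' / min c 1) =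
        (fun i : Fin (k + 1) => if (i : ℕ) < k then 4 * A / (fun j : Fin (k + 1) => ρt (k + 1) j) i else 8 * A' / min c 1) := by
      funext i
      simp only [Nat.add_lt_add_iff_right]
    rw [e]
    exact youngLipschitz_box_of_coordHolo_vertex ((S K) k) (sp K k) (fun j : Fin (k + 1) => ρt (k + 1) j) (fun j => hρt _ _) hc
      (hOld K k) (hLast K k)
  exact windowedNE9_localizedSum_of_activitySlots F m' M hM S emb ρ bV W (fun _ k => box γ k) (fun g hg _ k => histPrefix_mem_box (hWγ hg) k) sp
    (fun n i => if i + 1 < n then 4 * A / ρt n i else 8 * A' / min c 1) hAγ hr₁ hκ hκ₀ hrate hsmall hΛ0 hδ₀ hB₃ hr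
    (fun K k => bound238_box_of_coordHoloLast ((S K) k) (sp K k) hA' hc (hLast K k)) hYL
    Ec ι Φ U hU hrU hHhol hΦemb hΦsp w hw₀ hw htail

end MarginDatum

/-! ## §3 ★★★ The (β′) letter with the activity holomorphy READ FROM PRINT (`AnalyticH`, [II] p. 15) -/

section PrintedLetter

variable (F : T4Family) {𝔸 : Type*} [NormedRing 𝔸] [NormedAlgebra ℂ 𝔸] {V : Type*} [NormedAddCommGroup V] [NormedSpace ℝ V]
  {ι' : Type*} [Fintype ι'] {M : ℕ}

open Classical in
/-- ★★★ **THE (β′) LETTER WITH THE ACTIVITY HOLOMORPHY READ FROM PRINT** (configuration algebra `𝔸` a normed ℂ-algebra, as of record; its ℝ-structure is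
`NormedAlgebra.complexToReal`).  dag-n22-w2's `windowedNE9_localizedSum_of_activitySlots` with its hypothesis `hHhol` DISCHARGED by §1 from W1's printed slot
`AnalyticH ((S K) k) (Wk K k) (sp K k)` at every `(K, k)` and holomorphic readings `Φ K k X` on `U K k X` (NODE A: [I] p. 264, the analytic extension of
`B ↦ U_{k+1}(exp iB)` composed with the pair reading): the displayed inputs are W1's THREE slots `Bound238` ∕ `YoungLipschitz` ∕ `AnalyticH`, the readings `Φ`
(holomorphic, chart clause, space clause), the soft site weights with the minimizer tails, numerals.
[cite: Balaban1987RG1, (1.7) p.261, (1.18) p.263, (1.20)-(1.21) p.264, (4.35)-(4.37) pp.290-291 and (5.10) p.293; Balaban1988RG2Cluster, (2.13) p.14, p.15, (2.38) p.20 and (2.39)-(2.41) p.21] -/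
theorem windowedNE9_localizedSum_of_printedSlots (m' : ℕ) (M : ℕ) [NeZero M] (hM : M = F.L ^ m')
    (S : (K : ℕ) → ClusterTower (F.P K) 𝔸 M) (emb : ReadingMaps F 𝔸 𝔸) (ρ : V →L[ℝ] 𝔸) (bV : Module.Basis ι' ℝ V) (W : Set (ℕ → ℝ))
    (Wk : (K k : ℕ) → Set (Fin (k + 1) → ℝ)) (hWk : ∀ g ∈ W, ∀ K k, histPrefix g k ∈ Wk K k)
    (sp : (K k : ℕ) → (domSys (F.P K) M (k + 1)).Dom → Set (CPair (F.P K) 𝔸))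
    {A R r₁ κ δ₀ B₃ r : ℝ} (Λ : ℕ → ℕ → ℝ)
    (hA : 0 < A) (hr₁ : 0 ≤ r₁) (hκ : κ ≤ r₁) (hκ₀ : kappa₀ (4 * 2 ^ 4) (2 * 4) ≤ κ / 2) (hrate : r₁ + 2 * (64 * Real.log 162) + 2 ≤ R)
    (hsmall : 2 * A * Real.exp (5 * r₁ + 1) * K₀ 64 8 * 9 * 64 ≤ 1) (hΛ : ∀ k i, 0 ≤ Λ k i) (hδ₀ : 0 < δ₀) (hB₃ : 0 ≤ B₃) (hr : 0 < r)
    (h238 : ∀ K k, ((S K) k).Bound238 (Wk K k) (sp K k) A R)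
    (hYL : ∀ K k, ((S K) k).YoungLipschitz (Wk K k) (sp K k) (fun i : Fin (k + 1) => Λ (k + 1) i) R)
    (hAn : ∀ K k, ((S K) k).AnalyticH (Wk K k) (sp K k))
    (Ec : ℕ → ℕ → Type*) [∀ K k, NormedAddCommGroup (Ec K k)] [∀ K k, NormedSpace ℂ (Ec K k)]
    (ι : (K k : ℕ) → (domSys (F.P K) M (k + 1)).Dom → ((Fin (F.P K).d → Site (F.P K) (k + 1) → V) →L[ℝ] Ec K k))
    (Φ : (K k : ℕ) → (domSys (F.P K) M (k + 1)).Dom → Ec K k → CPair (F.P K) 𝔸)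
    (U : (K k : ℕ) → (domSys (F.P K) M (k + 1)).Dom → Set (Ec K k)) (hU : ∀ K k X, IsOpen (U K k X)) (hrU : ∀ K k X, ball (0 : Ec K k) r ⊆ U K k X)
    (hΦhol : ∀ (K k : ℕ) (X : (domSys (F.P K) M (k + 1)).Dom), DifferentiableOn ℂ (Φ K k X) (U K k X))
    (hΦemb : ∀ (K k : ℕ) (X : (domSys (F.P K) M (k + 1)).Dom) (B : Fin (F.P K).d → Site (F.P K) (k + 1) → V),
      Φ K k X (ι K k X B) = emb K k (fun l t => NormedSpace.exp (ρ (B l t))))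
    (hΦsp : ∀ (K k : ℕ) (X : (domSys (F.P K) M (k + 1)).Dom), ∀ z ∈ U K k X, ∀ Z : (domSys (F.P K) M (k + 1)).Dom, Z.1 ⊆ X.1 → Φ K k X z ∈ sp K k Z)
    (w : (K k : ℕ) → (domSys (F.P K) M (k + 1)).Dom → Site (F.P K) (k + 1) → ℝ) (hw₀ : ∀ K k X t, 0 ≤ w K k X t)
    (hw : ∀ (K k : ℕ) (X : (domSys (F.P K) M (k + 1)).Dom) (l : Fin (F.P K).d) (t : Site (F.P K) (k + 1)) (c : ι'),
      ‖ι K k X (Pi.single l (Pi.single t (bV c)))‖ ≤ w K k X t)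
    (htail : ∀ (K k : ℕ) (X : (domSys (F.P K) M (k + 1)).Dom) (t : Site (F.P K) (k + 1)),
      let e : Site (F.P K) (k + 1) → TPt 4 (domCount (F.P K) M (k + 1) * M) := fun x i => (ZMod.cast (x i) : ZMod (domCount (F.P K) M (k + 1) * M))
      w K k X t ≤ B₃ * Real.exp (-δ₀ * distCT (domCount (F.P K) M (k + 1)) M (e t) (nearT (M := M) (e t) X))) :
    WindowedNE9 F (localizedSum F S emb) ρ bV W (delta1 δ₀ κ ((M : ℝ) * 4))
      (fun k i => (16 * (8 * (Real.exp 1 * 9 * 64 * K₀ 64 8 ^ 2)) * B₃ ^ 2 / r ^ 2) *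
        Real.exp (delta1 δ₀ κ ((M : ℝ) * 4) * ((M : ℝ) * 4) * 3) * K₀ (4 * 2 ^ 4) (2 * 4) * K₁ 4 (δ₀ / 2) * Λ k i) :=
  windowedNE9_localizedSum_of_activitySlots F m' M hM S emb ρ bV W Wk hWk sp Λ hA hr₁ hκ hκ₀ hrate hsmall hΛ hδ₀ hB₃ hr h238 hYL Ec ι Φ U hU hrU
    (fun g hg K k X => differentiableOn_H_comp_of_analyticH ((S K) k) (Wk K k) (sp K k) (hAn K k) (hWk g hg K k) (Φ K k X) (hΦhol K k X) X
      (hΦsp K k X))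
    hΦemb hΦsp w hw₀ hw htail

end PrintedLetter

end YMDAG.N22.WindowedOfCouplingHolo

end
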